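import Summits.BirchSwinnertonDyer.Rank1Residual.GaloisImage.NineTorsionScalarStabiliserTower
import Summits.BirchSwinnertonDyer.Rank1Residual.GaloisImage.HauptmodulNineValuationFour
import Summits.BirchSwinnertonDyer.Rank1Residual.GaloisImage.HauptmodulThreeShapeValuation
import Summits.BirchSwinnertonDyer.Rank1Residual.GaloisImage.HauptmodulNineInvariant
import HarnessLib

/-!
# The `3`-adic tower on the EXOTIC core at `v₃(j) = 4`: `ρ̄_{E,3}` onto and `v₃(j(E)) = 4`
# imply `ρ̄_{E,3ⁿ}` onto for every `n` — via the level-`9` Hauptmodul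
# (cell `b2b-bsdres`, team n1011, seat p02 gen 5 — row T-b11-F4 'scalar-stabiliser tower criterion
# at 9', file F4c-H5: the assembly of the Hauptmodul route for the family `v₃(j) = 4`)

HONEST FRAMING (cell `b2b-bsdres`, run/shared/lean/b2b/bsd-rank1-residual/, verbatim in every
file): the goal of the cell is to DELETE the COMBINATION-SHAPED residual classes of the
Birch–Swinnerton-Dyer formula for ALL analytic-rank `≤ 1` elliptic curves over `ℚ` — "full BSD
formula for every rank `≤ 1` curve in class `C`" assembled STRICTLY from published theorems — so
that the rank-`≤ 1` remainder becomes exactly the CONSTRUCTION-SHAPED classes, which are TYPED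
(missing-input `Prop`s), NOT attempted. This is not "finishing BSD". Team n1011 (N10 / N11):
research route; no claim beyond the stated classes; labels UNCHANGED; nothing is booked. Theorems
only (no definition, no named fact).

## What this file proves

* `padicValRat_j_sub_1728_of_padicValRat_j_eq_four` — `v₃(j) = 4 ⟹ v₃(j − 1728) = 3`
  (`1728 = 2⁶·3³`): the family `v₃(j) = 4` lies in the potentially-good wild stratum `m = 3` that
  the completed-square / Vélu witnesses of `WildThreeAdicTower` (`m ∈ {1, 2, 4}`) do not reach.
* **`towerSurj_three_of_surj_of_padicValRat_j_eq_four`** — for `E/ℚ` with `ρ̄_{E,3}` onto and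
  `v₃(j(E)) = 4`: `ρ̄_{E,3ⁿ}` is onto for every `n`.  Assembly:
  (1) `HauptmodulThreeShapeValuation`: a point `Q ∈ E(ℚ̄)` of order `9` with `T = 3Q` affine and
      `v(S)³ = v(3)³`, `S = A₁(T)³/A₃(T)` the level-`3` Hauptmodul of `(E, ⟨T⟩)` — so `v(S) = v(3)`
      (`⟨T⟩` is NOT the canonical subgroup);
  (2) `HauptmodulNineInvariant`: `θ = η(E, ℤQ) + 3 ∈ ℚ(E[9])` is fixed by every `σ ∈ Γ_ℚ` with
      `σQ ∈ ℤQ`, `j(θ³ − 27) = θ³(θ³ − 24)³` and `S = θ³`;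
  (3) `HauptmodulNineValuationFour` (curve-free): `v₃(j) = 4`, `v(θ³) = v(3)` ⟹
      `z = 9θ²/(θ³ − 6)² − 1` has `v(z)⁹ = v(3)`;
  (4) `NineTorsionScalarStabiliserTower` (F4a ramification socket + F4b scalar-stabiliser socket +
      Serre IV-23, p252833): a non-zero `Stab(ℤQ)`-invariant in `ℚ(E[9])` with
      `v(z)⁹·v(3)⁰ = v(3)¹` (`9` coprime to `0 − 1`) forces the tower from surj(3).
* `imageContainsSL2_three_of_surj_of_padicValRat_j_eq_four` — Kato's (12.5.2) at `p = 3` for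
  this family.

This discharges, by a KERNEL PROOF and with no reduction theory, the largest family of the EXOTIC
core of the cell's `3`-adic census (the rows with `v₃(j − 1728) = 3`, `v₃(j) = 4`: 142 of the 749
`m = 3` cells; EVIDENCE kit j134538 found `v(z) = 1/9` on all of them).  The remaining `m = 3`
families (`v₃(j) = 5`: 117 cells; `v₃(j) = 3` with `c₆/27 ≡ ±1 (mod 9)`-type classes: 84 cells;
and the rest) are NOT claimed here.  Nothing booked; no label change.

References: [Maier2006] Table 4 (N = 3, 9), §5; [SerreAbelianLadic1968] IV-23;
[SerreLocalFields1979] Ch. I §7; [Kato2004Asterisque] (12.5.2).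
-/

noncomputable section

set_option maxRecDepth 10000

open scoped Classical

open WeierstrassCurve Field

namespace Summit.BirchSwinnertonDyer.Rank1Residual.GaloisImage

open Literature.NumberTheory.EllipticCurves Literature.NumberTheory.GaloisRepresentations
  Rat.HeightOneSpectrum

variable (W : WeierstrassCurve ℚ) [W.IsElliptic]

/-- `v₃(j) = 4 ⟹ v₃(j − 1728) = 3` (`v₃(1728) = 3 < 4`). [folklore] -/
theorem padicValRat_j_sub_1728_of_padicValRat_j_eq_four (hj4 : padicValRat 3 W.j = 4) :
    padicValRat 3 (W.j - 1728) = ((3 : ℕ) : ℤ) := by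
  haveI : Fact (Nat.Prime 3) := ⟨Nat.prime_three⟩
  have h1728 : padicValRat 3 (1728 : ℚ) = 3 := by
    rw [show (1728 : ℚ) = ((3 ^ 3 * 64 : ℕ) : ℚ) by norm_num, padicValRat.of_nat,
      padicValNat.mul (by norm_num) (by norm_num), padicValNat.prime_pow,
      padicValNat.eq_zero_of_not_dvd (by norm_num : ¬ 3 ∣ 64)]
    norm_num
  have hj0 : W.j ≠ 0 := by
    intro h; rw [h, padicValRat.zero] at hj4; norm_num at hj4
  have hne : W.j + (-1728) ≠ 0 := by
    intro h
    have h' : W.j = 1728 := by linear_combination h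
    rw [h', h1728] at hj4
    norm_num at hj4
  rw [sub_eq_add_neg, padicValRat.add_eq_min hne hj0 (by norm_num)
    (by rw [padicValRat.neg, h1728, hj4]; norm_num), padicValRat.neg, h1728, hj4]
  norm_num

/-- **THE TOWER AT `v₃(j) = 4`.**  For `E/ℚ` with `ρ̄_{E,3}` onto and `v₃(j(E)) = 4`, `ρ̄_{E,3ⁿ}`
is onto for every `n`.  (Level-`9` Hauptmodul: the `Stab(ℤQ)`-invariant
`z = 9θ²/(θ³ − 6)² − 1 ∈ ℚ(E[9])`, `θ = η(E, ℤQ) + 3`, has `3`-adic valuation exactly `1/9` for a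
`9`-torsion point `Q` above a non-canonical `3`-torsion point; the scalar-stabiliser tower criterion
then applies.) [cite: SerreAbelianLadic1968, Ch. IV §3.4, Lemma 3 (IV-23)]
[cite: Maier2006, Table 4 (N = 9) and §5] -/
theorem towerSurj_three_of_surj_of_padicValRat_j_eq_four (hsurj : W.HasSurjectiveModNGaloisRep 3)
    (hj4 : padicValRat 3 W.j = 4) (n : ℕ) : W.HasSurjectiveModNGaloisRep (3 ^ n : ℕ) := by
  haveI : Fact (Nat.Prime 3) := ⟨Nat.prime_three⟩
  set v := (placeOver 3).valuation with hv
  set t := v (3 : AlgebraicClosure ℚ) with ht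
  have ht0 : t ≠ 0 := valuation_three_ne_zero
  -- (1) a `9`-torsion point above a non-canonical `3`-torsion point, `v(S(3Q))³ = t³`
  have hj3 := padicValRat_j_sub_1728_of_padicValRat_j_eq_four W hj4
  obtain ⟨Q, x₃, y₃, h₃, hQ9, hQ3, -, hvalS⟩ :=
    exists_nineTorsion_hauptmodul_three_valuation W (m := 3) (by norm_num) (by norm_num) hj3
  have h3Q : (3 ^ 1 : ℕ) • Q ≠ 0 := by
    rw [pow_one, ← natCast_zsmul, Nat.cast_ofNat, hQ3]
    exact Affine.Point.some_ne_zero h₃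
  have h9Q : (3 ^ (1 + 1) : ℕ) • Q = 0 := by
    rw [← natCast_zsmul]; exact_mod_cast hQ9
  have h9 : addOrderOf Q = 9 := by
    have := addOrderOf_eq_prime_pow h3Q h9Q
    norm_num at this
    exact this
  -- (2) the invariant `θ`
  obtain ⟨θ, hθL, hθfix, hjθ, hSθ⟩ := exists_hauptmodulNine_invariant W h9 hQ3
  have hSθ' : (W.map (algebraMap ℚ (AlgebraicClosure ℚ))).tgA₁ x₃ y₃ ^ 3 /
      (W.map (algebraMap ℚ (AlgebraicClosure ℚ))).tgA₃ x₃ y₃ = θ ^ 3 := hSθ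
  rw [hSθ'] at hvalS
  have hvS : v (θ ^ 3) = t := (pow_left_inj₀ zero_le zero_le three_ne_zero).mp hvalS
  -- (3) the curve-free core: `v(z)⁹ = t`
  obtain ⟨h6, hz⟩ := valuation_hauptmodul_nine_invariant_pow_nine hj4 hjθ hvS rfl
  have hz0 : 9 * θ ^ 2 / (θ ^ 3 - 6) ^ 2 - 1 ≠ 0 := by
    intro h0
    rw [h0, map_zero, zero_pow (by norm_num)] at hz
    exact ht0 hz.symm
  -- `z ∈ ℚ(E[9])` and `z` is `Stab(ℤQ)`-invariant
  have hzL : 9 * θ ^ 2 / (θ ^ 3 - 6) ^ 2 - 1 ∈ W.divisionField 9 :=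
    sub_mem (div_mem (mul_mem (ofNat_mem _ 9) (pow_mem hθL 2))
      (pow_mem (sub_mem (pow_mem hθL 3) (ofNat_mem _ 6)) 2)) (one_mem _)
  have hfix : ∀ σ : absoluteGaloisGroup ℚ, (∃ k : ℤ, σ • Q = k • Q) →
      σ • (9 * θ ^ 2 / (θ ^ 3 - 6) ^ 2 - 1) = 9 * θ ^ 2 / (θ ^ 3 - 6) ^ 2 - 1 := by
    intro σ hσ
    have hθ' : absoluteGaloisGroup.toAlgEquiv ℚ σ θ = θ := by
      rw [← absoluteGaloisGroup.smul_def]; exact hθfix σ hσ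
    rw [absoluteGaloisGroup.smul_def]
    simp only [map_sub, map_div₀, map_mul, map_pow, map_ofNat, map_one, hθ']
  -- (4) the scalar-stabiliser tower criterion
  have hQ₉ : Q ∈ geomTorsion W 9 := (Submodule.mem_torsionBy_iff _ _).mpr hQ9
  have hval : v (9 * θ ^ 2 / (θ ^ 3 - 6) ^ 2 - 1) ^ 9 * t ^ 0 = t ^ 1 := by
    rw [pow_zero, mul_one, pow_one]; exact hz
  have hcop : IsCoprime ((9 : ℕ) : ℤ) (((0 : ℕ) : ℤ) - ((1 : ℕ) : ℤ)) :=
    ⟨0, -1, by norm_num⟩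
  exact towerSurj_three_of_surj_of_valuation_of_smul_zmultiples W hsurj hQ₉ hzL hz0 hfix hval hcop
    (dvd_refl 9) n

/-- **Kato's (12.5.2) at `p = 3` on the family `v₃(j) = 4`** from surj(3).
[cite: Kato2004Asterisque, (12.5.2) (p. 222)] [cite: SerreAbelianLadic1968, Ch. IV §3.4, Lemma 3 (IV-23)] -/
theorem imageContainsSL2_three_of_surj_of_padicValRat_j_eq_four
    (hsurj : W.HasSurjectiveModNGaloisRep 3) (hj4 : padicValRat 3 W.j = 4) :
    Kato2004.ImageContainsSL2 W 3 := by
  haveI : Fact (Nat.Prime 3) := ⟨Nat.prime_three⟩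
  exact (Kato2004.imageContainsSL2_iff_forall_hasSurjectiveModNGaloisRep W 3).mpr
    (towerSurj_three_of_surj_of_padicValRat_j_eq_four W hsurj hj4)

end Summit.BirchSwinnertonDyer.Rank1Residual.GaloisImage
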